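import Summits.CriticalPhenomena.PercolationContinuityZ3.Theorems.PercNearOneGluingNoHeavyQuantFarPieceBlob
import Summits.CriticalPhenomena.PercolationContinuityZ3.Theorems.PercNearOneGluingNoHeavyQuantSubfloorTripleHub
import Summits.CriticalPhenomena.PercolationContinuityZ3.Theorems.PercNearOneGluingNoHeavyQuantSDECBlobs
import Summits.CriticalPhenomena.PercolationContinuityZ3.Theorems.PercNearOneGluingNoHeavyQuantSiblingMixture
import Summits.CriticalPhenomena.PercolationContinuityZ3.Theorems.PercNearOneGluingNoHeavyQuantLightSiblingRelays
import HarnessLib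

/-!
# QUANT lane R8, T-DEC: THREE GLUED CHILDREN ARE SDEC AT THE TRUE FLOOR — the new minimal open instance of the sibling step
# (`R[q₁](R²[g₁]) ⊔ R[q₂](R²[g₂]) ⊔ R[q₃](R²[g₃])`, all `mᵢ = qᵢ(1+2gᵢ) ≥ 2`, every floor `x ≤ min qᵢgᵢ`), oracle-free, by the piece expansion

builds on p205010 (kernel theorem, internal audit signed; external expert review pending)

Support file (`--supports stmt-CriticalPhenomena-4575`), QUANT lane seat prim-quant-census-1 (gen 30); memo
`run/shared/lean/prim/quant/prim-quant-census-1/g30/SUBFLOOR-HUBS-G30.md` §3.  Theorems only (standard axioms, no sorries): the ASSEMBLY over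
this seat's three cores — `sdec_farPieceBlob` (✓ `…QuantFarPieceBlob`), `sdec_pairHub` (✓ `…QuantSubfloorPairHub`), `sdec_tripleHub`
(✓ `…QuantSubfloorTripleHub`) —, the blob slice `sdec_slice'` (typer g40), `sdec_of_mixture` / `lconv_mix_right` (arm-1 g55), `sdec_lconv_point`
(arm-1 g56), `lconv_gate_point_eq_slice` (census-2).

WHY THIS INSTANCE (RATE-PLAN §58.4, memo §0).  After COMP-SLICE (✓ p547225) and HIGH-CONV (✓ p548056) the node `SiblingStep` owes only forests
ALL of whose siblings are heavy-unfloored.  The smallest heavy-unfloored sibling is the glued child `R[q](R²[g])` with `m = q(1+2g) > 2` at floors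
`x > (m−1)/2` (not tame; not hull+high: its mean fibre is the segment from `blob₃(m/3)` to the far-giant piece `C((m−1)/2) = {1,3;(m−1)/2}`,
`…QuantHullHigh` HONEST STATUS); width 2 is free on the binder (two-root identity) but width 3 was open — the analogue, inside the residue, of
README V393's "three 2-chains" (closed by arm-1 g55 `sdec_tc3g`).
THE PROOF = THE PIECE EXPANSION.  `gate{1,3;g}q = α·blob₃(m/3) + (1−α)·C((m−1)/2)` exactly (`gate_gluedChild_eq_mix`, `α = 3(1−q)/(3−m)`);
expanding the three siblings gives 8 terms `C_S ∗ blob_{Sᶜ}`; heavy blobs are slices (`sdec_blob3_step`); the cores are `C ∗ blob₃` (|S| = 1),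
the pair hub (|S| = 2), the triple hub (|S| = 3); all terms have mean `Σ mᵢ`, so `sdec_of_mixture` reassembles them.
* `cp_laws`, `blob3_laws`, `gluedChild_laws`, `lconv_laws`, **`sdec_mix_laws`** (mixture step with law facts), **`sdec_blob3_step`** (slice step
  with law facts), `gluedChild_params`, **`gate_gluedChild_eq_mix`** (the forced mixture), **`sdec_gluedChild`** (one glued child, `x ≤ qg`).
* **`sdec_farPiece_gluedChild`** (`C(γ) ∗ t`), **`sdec_gluedChildren2`** (`t_b ∗ t_a`, with law facts), **`sdec_farPiece_gluedChildren2`**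
  (`C(γ) ∗ (t_b ∗ t_a)`), **`sdec_gluedChildren3`**: `SDEC x 9 (t₃ ∗ t₂ ∗ t₁)` for all `0 < qᵢ, gᵢ < 1` with `qᵢ(1+2gᵢ) ≥ 2` and every
  `0 < x ≤ min qᵢgᵢ` (⊇ every tree-OK floor `x ≤ qᵢ·x₁`, `x₁ < gᵢ`), and the forest-law form **`sdec_gluedChildren3_flaw`** (`flaw` of the three
  `Sib` records `⟨qᵢ, ·, ·, 3, {1,3;gᵢ}⟩`).
HONEST STATUS.  One instance family (three glued children, 6 parameters + the floor) of the node's residue, unconditionally; mixed forests (a glued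
child of mean < 2 beside two heavy ones) are covered by arm-1's `sdec_cons_of_tame` only on the binder.  The k-general object behind it is the
sub-floor hub conjecture HUB-FAR (memo §0 (3)).  `SiblingStep` ⟺ `GateStepN`, `FarTreeRow` OPEN; RATE class (log\*) / honest sentence of
`run/shared/lean/prim/quant/README.md` unchanged.  [this work].  Nothing here is cited as a published result.  The gluing rows served
[cite: KozmaNitzan2024, Conjecture 3 (p. 15)]; product measure [cite: Grimmett1999, §1.3 p. 10].
-/

noncomputable section

open scoped BigOperators

namespace Summit.CriticalPhenomena.PercolationContinuityZ3.Theorems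
namespace Quant
namespace LawDec

open Finset

/-- the point mass `δ_K` -/
local notation3 "δ[" K "]" => (fun k : ℕ => if k = (K : ℕ) then (1 : ℝ) else 0)

/-- the law `{1, 3; a}`: the glued pair under a sure relay `δ₁ ∗ gate δ₂ a` (the glued child's sub-forest law for `a = g`, its far-giant
piece for `a = (m−1)/2`) -/
local notation3 "CP[" a "]" => (fun h : ℕ => (1 - (a : ℝ)) * (if h = 1 then (1 : ℝ) else 0) + (a : ℝ) * (if h = 3 then (1 : ℝ) else 0))

/-! ### Law facts of the building blocks -/

/-- law facts of `{1,3;a}` (`0 ≤ a ≤ 1`): nonnegative, vanishing above `3`, mass `1`, mean `1 + 2a`. [this work] -/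
theorem cp_laws {a : ℝ} (h0 : 0 ≤ a) (h1 : a ≤ 1) :
    (∀ h, 0 ≤ CP[a] h) ∧ (∀ h, 3 < h → CP[a] h = 0) ∧ ∑ h ∈ Finset.range (3 + 1), CP[a] h = 1 ∧
      ∑ h ∈ Finset.range (3 + 1), (h : ℝ) * CP[a] h = 1 + 2 * a := by
  refine ⟨fun h => ?_, fun h hh => ?_, ?_, ?_⟩
  · dsimp only; split_ifs <;> linarith
  · dsimp only; rw [if_neg (by omega), if_neg (by omega)]; ring
  · simp [Finset.sum_range_succ]
  · simp [Finset.sum_range_succ]; ring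

/-- law facts of the gated 3-blob `gate δ₃ s` (`0 ≤ s ≤ 1`): nonnegative, vanishing above `3`, mass `1`, mean `3s`. [this work] -/
theorem blob3_laws {s : ℝ} (h0 : 0 ≤ s) (h1 : s ≤ 1) :
    (∀ h, 0 ≤ gate δ[3] s h) ∧ (∀ h, 3 < h → gate δ[3] s h = 0) ∧ ∑ h ∈ Finset.range (3 + 1), gate δ[3] s h = 1 ∧
      ∑ h ∈ Finset.range (3 + 1), (h : ℝ) * gate δ[3] s h = 3 * s := by
  have d0 : ∀ h, 0 ≤ δ[3] h := fun h => by dsimp only; split_ifs <;> norm_num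
  have dM : ∀ h, 3 < h → δ[3] h = 0 := fun h hh => by dsimp only; rw [if_neg (by omega)]
  have d1 : ∑ h ∈ Finset.range (3 + 1), δ[3] h = 1 := by simp
  obtain ⟨g0, gM, g1⟩ := gate_laws 3 δ[3] s h0 h1 d0 dM d1
  refine ⟨g0, gM, g1, ?_⟩
  rw [sum_mul_gate]; simp; ring

/-- law facts of the gated glued child `gate {1,3;g} q` (`0 ≤ q ≤ 1`, `0 ≤ g ≤ 1`): mass `1`, mean `q(1+2g)`. [this work] -/
theorem gluedChild_laws {q g : ℝ} (hq0 : 0 ≤ q) (hq1 : q ≤ 1) (hg0 : 0 ≤ g) (hg1 : g ≤ 1) :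
    (∀ h, 0 ≤ gate CP[g] q h) ∧ (∀ h, 3 < h → gate CP[g] q h = 0) ∧ ∑ h ∈ Finset.range (3 + 1), gate CP[g] q h = 1 ∧
      ∑ h ∈ Finset.range (3 + 1), (h : ℝ) * gate CP[g] q h = q * (1 + 2 * g) := by
  obtain ⟨c0, cM, c1, cmean⟩ := cp_laws hg0 hg1
  obtain ⟨g0, gM, g1⟩ := gate_laws 3 CP[g] q hq0 hq1 c0 cM c1
  exact ⟨g0, gM, g1, by rw [sum_mul_gate, cmean]⟩

/-- law facts of a convolution from those of its factors (means add). [this work] -/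
theorem lconv_laws {M₁ M₂ : ℕ} {μ₁ μ₂ : ℕ → ℝ} {m₁ m₂ : ℝ} (a0 : ∀ h, 0 ≤ μ₁ h) (a1 : ∑ h ∈ Finset.range (M₁ + 1), μ₁ h = 1)
    (am : ∑ h ∈ Finset.range (M₁ + 1), (h : ℝ) * μ₁ h = m₁) (b0 : ∀ h, 0 ≤ μ₂ h) (b1 : ∑ h ∈ Finset.range (M₂ + 1), μ₂ h = 1)
    (bm : ∑ h ∈ Finset.range (M₂ + 1), (h : ℝ) * μ₂ h = m₂) :
    (∀ h, 0 ≤ lconv M₁ M₂ μ₁ μ₂ h) ∧ (∀ h, M₁ + M₂ < h → lconv M₁ M₂ μ₁ μ₂ h = 0) ∧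
      ∑ h ∈ Finset.range (M₁ + M₂ + 1), lconv M₁ M₂ μ₁ μ₂ h = 1 ∧
      ∑ h ∈ Finset.range (M₁ + M₂ + 1), (h : ℝ) * lconv M₁ M₂ μ₁ μ₂ h = m₁ + m₂ :=
  ⟨lconv_nonneg _ _ _ _ a0 b0, fun h hh => lconv_eq_zero _ _ _ _ h hh, sum_lconv _ _ _ _ a1 b1,
    by rw [sum_mul_lconv _ _ _ _ a1 b1, am, bm]⟩

/-- **SDEC along a same-mean mixture, with the law facts of the mixture** (`sdec_of_mixture`). [this work] -/
theorem sdec_mix_laws {x p m : ℝ} {M : ℕ} {μ μ₁ μ₂ : ℕ → ℝ} (hp0 : 0 ≤ p) (hp1 : p ≤ 1)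
    (hμ : ∀ h, μ h = p * μ₁ h + (1 - p) * μ₂ h)
    (a0 : ∀ h, 0 ≤ μ₁ h) (aM : ∀ h, M < h → μ₁ h = 0) (a1 : ∑ h ∈ Finset.range (M + 1), μ₁ h = 1)
    (am : ∑ h ∈ Finset.range (M + 1), (h : ℝ) * μ₁ h = m)
    (b0 : ∀ h, 0 ≤ μ₂ h) (bM : ∀ h, M < h → μ₂ h = 0) (b1 : ∑ h ∈ Finset.range (M + 1), μ₂ h = 1)
    (bm : ∑ h ∈ Finset.range (M + 1), (h : ℝ) * μ₂ h = m) (h₁ : SDEC x M μ₁) (h₂ : SDEC x M μ₂) :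
    (∀ h, 0 ≤ μ h) ∧ (∀ h, M < h → μ h = 0) ∧ ∑ h ∈ Finset.range (M + 1), μ h = 1 ∧
      ∑ h ∈ Finset.range (M + 1), (h : ℝ) * μ h = m ∧ SDEC x M μ := by
  have hm : ∑ h ∈ Finset.range (M + 1), (h : ℝ) * μ h = m := by
    have e : ∀ h : ℕ, (h : ℝ) * μ h = p * ((h : ℝ) * μ₁ h) + (1 - p) * ((h : ℝ) * μ₂ h) := fun h => by rw [hμ]; ring
    rw [Finset.sum_congr rfl fun h _ => e h, Finset.sum_add_distrib, ← Finset.mul_sum, ← Finset.mul_sum, am, bm]; ring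
  refine ⟨fun h => ?_, fun h hh => ?_, ?_, hm, ?_⟩
  · rw [hμ]; exact add_nonneg (mul_nonneg hp0 (a0 h)) (mul_nonneg (by linarith) (b0 h))
  · rw [hμ, aM h hh, bM h hh]; ring
  · rw [Finset.sum_congr rfl fun h _ => hμ h, Finset.sum_add_distrib, ← Finset.mul_sum, ← Finset.mul_sum, a1, b1]; ring
  · exact sdec_of_mixture x M μ μ₁ μ₂ p hp0 hp1 hμ (am.trans hm.symm) (bm.trans hm.symm) h₁ h₂

/-- **the blob-slice step with law facts**: an SDEC law `μ` on `{0..M}` (mass 1, mean `m ≥ x·M`) convolved with the heavy 3-blob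
`gate δ₃ s` (`x ≤ s ≤ 1`) is SDEC on `{0..M+3}` with mean `m + 3s` (`sdec_slice'` of typer g40 / census-2). [this work] -/
theorem sdec_blob3_step {x s m : ℝ} {M : ℕ} {μ : ℕ → ℝ} (hx0 : 0 < x) (hx1 : x < 1) (hxs : x ≤ s) (hs1 : s ≤ 1)
    (μ0 : ∀ h, 0 ≤ μ h) (μM : ∀ h, M < h → μ h = 0) (μ1 : ∑ h ∈ Finset.range (M + 1), μ h = 1)
    (μm : ∑ h ∈ Finset.range (M + 1), (h : ℝ) * μ h = m) (hta : x * (M : ℝ) ≤ m) (hS : SDEC x M μ) :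
    (∀ h, 0 ≤ lconv M 3 μ (gate δ[3] s) h) ∧ (∀ h, M + 3 < h → lconv M 3 μ (gate δ[3] s) h = 0) ∧
      ∑ h ∈ Finset.range (M + 3 + 1), lconv M 3 μ (gate δ[3] s) h = 1 ∧
      ∑ h ∈ Finset.range (M + 3 + 1), (h : ℝ) * lconv M 3 μ (gate δ[3] s) h = m + 3 * s ∧
      SDEC x (M + 3) (lconv M 3 μ (gate δ[3] s)) := by
  obtain ⟨e0, eM, e1, emean⟩ := blob3_laws (hx0.le.trans hxs) hs1
  obtain ⟨B0, BM, B1, Bmean⟩ := lconv_laws μ0 μ1 μm e0 e1 emean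
  refine ⟨B0, BM, B1, Bmean, ?_⟩
  rw [lconv_gate_point_eq_slice M 3 μ s μM]
  exact sdec_slice' x s M 3 μ hx0 hx1 hxs hs1 μ0 μM μ1 (by rw [μm]; exact hta) hS

/-! ### The glued child and its forced mixture -/

/-- parameter facts of a glued child `R[q](R²[g])` with `m = q(1+2g) ≥ 2`: `α = 3(1−q)/(3−m) ∈ [0,1]`, `s = m/3 ∈ [2/3, 1)`,
`γ = (m−1)/2 ∈ [1/2, 1)`. [this work] -/
theorem gluedChild_params {q g : ℝ} (hq0 : 0 < q) (hq1 : q < 1) (hg0 : 0 < g) (hg1 : g < 1) (hm : 2 ≤ q * (1 + 2 * g)) :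
    0 < 3 - q * (1 + 2 * g) ∧ 0 ≤ 3 * (1 - q) / (3 - q * (1 + 2 * g)) ∧ 3 * (1 - q) / (3 - q * (1 + 2 * g)) ≤ 1 ∧
      2 / 3 ≤ q * (1 + 2 * g) / 3 ∧ q * (1 + 2 * g) / 3 < 1 ∧
      1 / 2 ≤ (q * (1 + 2 * g) - 1) / 2 ∧ (q * (1 + 2 * g) - 1) / 2 < 1 := by
  have h1 : q * (1 + 2 * g) < 1 + 2 * g := by nlinarith
  have h3 : 0 < 3 - q * (1 + 2 * g) := by linarith
  have h2 : q * (1 + 2 * g) ≤ 3 * q := by nlinarith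
  refine ⟨h3, div_nonneg (by linarith) h3.le, ?_, by linarith, by linarith, by linarith, by linarith⟩
  rw [div_le_one h3]; linarith

/-- **THE FORCED MIXTURE**: the gated glued child is `α·blob₃(m/3) + (1−α)·{1,3;(m−1)/2}` pointwise (`m = q(1+2g)`, `α = 3(1−q)/(3−m)`;
`q < 1`, `g < 1`). [this work] -/
theorem gate_gluedChild_eq_mix {q g : ℝ} (hq1 : q < 1) (hg0 : 0 ≤ g) (hg1 : g < 1) (h : ℕ) :
    gate CP[g] q h = 3 * (1 - q) / (3 - q * (1 + 2 * g)) * gate δ[3] (q * (1 + 2 * g) / 3) h +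
      (1 - 3 * (1 - q) / (3 - q * (1 + 2 * g))) * CP[(q * (1 + 2 * g) - 1) / 2] h := by
  have h3 : 3 - q * (1 + 2 * g) ≠ 0 := by nlinarith
  -- values of the three laws at the atoms `0, 1, 2, 3` and above
  have L0 : gate CP[g] q 0 = 1 - q := by rw [gate_apply]; norm_num
  have L1 : gate CP[g] q 1 = q * (1 - g) := by rw [gate_apply]; norm_num
  have L2 : gate CP[g] q 2 = 0 := by rw [gate_apply]; norm_num
  have L3 : gate CP[g] q 3 = q * g := by rw [gate_apply]; norm_num
  have LM : ∀ k, 4 ≤ k → gate CP[g] q k = 0 := by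
    intro k hk; rw [gate_apply]; simp [show k ≠ 1 by omega, show k ≠ 3 by omega, show k ≠ 0 by omega]
  have B0 : gate δ[3] (q * (1 + 2 * g) / 3) 0 = 1 - q * (1 + 2 * g) / 3 := by rw [gate_apply]; norm_num
  have B1 : gate δ[3] (q * (1 + 2 * g) / 3) 1 = 0 := by rw [gate_apply]; norm_num
  have B2 : gate δ[3] (q * (1 + 2 * g) / 3) 2 = 0 := by rw [gate_apply]; norm_num
  have B3 : gate δ[3] (q * (1 + 2 * g) / 3) 3 = q * (1 + 2 * g) / 3 := by rw [gate_apply]; norm_num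
  have BM : ∀ k, 4 ≤ k → gate δ[3] (q * (1 + 2 * g) / 3) k = 0 := by
    intro k hk; rw [gate_apply]; simp [show k ≠ 3 by omega, show k ≠ 0 by omega]
  have C0 : CP[(q * (1 + 2 * g) - 1) / 2] 0 = 0 := by norm_num
  have C1 : CP[(q * (1 + 2 * g) - 1) / 2] 1 = 1 - (q * (1 + 2 * g) - 1) / 2 := by norm_num
  have C2 : CP[(q * (1 + 2 * g) - 1) / 2] 2 = 0 := by norm_num
  have C3 : CP[(q * (1 + 2 * g) - 1) / 2] 3 = (q * (1 + 2 * g) - 1) / 2 := by norm_num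
  have CM : ∀ k, 4 ≤ k → CP[(q * (1 + 2 * g) - 1) / 2] k = 0 := by
    intro k hk; simp [show k ≠ 1 by omega, show k ≠ 3 by omega]
  rcases Nat.lt_or_ge h 4 with hh | hh
  · interval_cases h
    · rw [L0, B0, C0, mul_zero, add_zero, div_mul_eq_mul_div, eq_div_iff h3]; ring
    · rw [L1, B1, C1, mul_zero, zero_add, one_sub_div h3, div_mul_eq_mul_div, eq_div_iff h3]; ring
    · rw [L2, B2, C2]; ring
    · rw [L3, B3, C3, one_sub_div h3, div_mul_eq_mul_div, div_mul_eq_mul_div, ← add_div, eq_div_iff h3]; ring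
  · rw [LM h hh, BM h hh, CM h hh]; ring

/-- **a single gated glued child is SDEC at every floor `0 < x ≤ qg`** (sure relay and blob slices, then the root gate). [this work] -/
theorem sdec_gluedChild {x q g : ℝ} (hq0 : 0 < q) (hq1 : q < 1) (hg0 : 0 < g) (hg1 : g < 1) (hx : x ≤ q * g) :
    SDEC x 3 (gate CP[g] q) := by
  have d0 : ∀ h, 0 ≤ δ[2] h := fun h => by dsimp only; split_ifs <;> norm_num
  have dM : ∀ h, 2 < h → δ[2] h = 0 := fun h hh => by dsimp only; rw [if_neg (by omega)]
  have d1 : ∑ h ∈ Finset.range (2 + 1), δ[2] h = 1 := by simp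
  have h2 : SDEC 1 2 δ[2] := sdec_point 1 one_pos le_rfl 2
  have h2g : SDEC g 2 (gate δ[2] g) := by
    have := sdec_gate h2 g hg0 hg1.le
    rw [mul_one] at this; exact this
  obtain ⟨b0, bM, b1⟩ := gate_laws 2 δ[2] g hg0.le hg1.le d0 dM d1
  have bmean : ∑ h ∈ Finset.range (2 + 1), (h : ℝ) * gate δ[2] g h = 2 * g := by
    rw [sum_mul_gate]; simp; ring
  have hcp := (sdec_lconv_point hg0 hg1 1 b0 bM b1 (by rw [bmean]; push_cast; linarith) h2g).2.2.2.2
  rw [← lconv_comm 1 2, farPiece_eq_lconv] at hcp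
  have hq : SDEC (q * g) 3 (gate CP[g] q) := sdec_gate hcp q hq0 hq1.le
  have hqg1 : q * g < 1 := by nlinarith
  exact sdec_mono hq hx hqg1

/-! ### The cores beside a glued child (width 2) -/

/-- **a far-giant piece beside a gated glued child is SDEC**: `{1,3;γ} ∗ gate {1,3;g} q` at every floor `0 < x ≤ qg` with `3x ≤ 1 + 2γ`,
`1/2 ≤ γ < 1`, `q(1+2g) ≥ 2` — the mixture of `C(γ) ∗ blob₃(m/3)` (`sdec_farPieceBlob`) and the pair hub `C(γ) ∗ C((m−1)/2)` (`sdec_pairHub`).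
[this work] -/
theorem sdec_farPiece_gluedChild {x γ q g : ℝ} (hx0 : 0 < x) (hγ : 1 / 2 ≤ γ) (hγ1 : γ < 1) (hxγ : 3 * x ≤ 1 + 2 * γ)
    (hq0 : 0 < q) (hq1 : q < 1) (hg0 : 0 < g) (hg1 : g < 1) (hm : 2 ≤ q * (1 + 2 * g)) (hx : x ≤ q * g) :
    (∀ h, 0 ≤ lconv 3 3 CP[γ] (gate CP[g] q) h) ∧ (∀ h, 3 + 3 < h → lconv 3 3 CP[γ] (gate CP[g] q) h = 0) ∧
      ∑ h ∈ Finset.range (3 + 3 + 1), lconv 3 3 CP[γ] (gate CP[g] q) h = 1 ∧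
      ∑ h ∈ Finset.range (3 + 3 + 1), (h : ℝ) * lconv 3 3 CP[γ] (gate CP[g] q) h = (1 + 2 * γ) + q * (1 + 2 * g) ∧
      SDEC x (3 + 3) (lconv 3 3 CP[γ] (gate CP[g] q)) := by
  obtain ⟨h3, α0, α1, s0, s1, γ0, γ1'⟩ := gluedChild_params hq0 hq1 hg0 hg1 hm
  obtain ⟨_, _, hxm, hx1⟩ := gluedChild_piece_facts hq0 hq1 hg0 hg1 hm hx
  have hxs : x ≤ q * (1 + 2 * g) / 3 := by linarith
  obtain ⟨c0, cM, c1, cmean⟩ := cp_laws (show (0 : ℝ) ≤ γ by linarith) hγ1.le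
  obtain ⟨e0, eM, e1, emean⟩ := blob3_laws (show (0 : ℝ) ≤ q * (1 + 2 * g) / 3 by linarith) s1.le
  obtain ⟨f0, fM, f1, fmean⟩ := cp_laws (show (0 : ℝ) ≤ (q * (1 + 2 * g) - 1) / 2 by linarith) γ1'.le
  -- the two components
  have hB : SDEC x (3 + 3) (lconv 3 3 CP[γ] (gate δ[3] (q * (1 + 2 * g) / 3))) := by
    rw [farPieceBlob_eq_lconv]; exact sdec_farPieceBlob hx0 hγ hγ1 s0 s1 hxs hxγ
  have hC : SDEC x (3 + 3) (lconv 3 3 CP[γ] CP[(q * (1 + 2 * g) - 1) / 2]) := by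
    rw [pairHub_eq_lconv]; exact sdec_pairHub hx0 hx1 hγ hγ1 γ0 γ1' hxγ hxm
  obtain ⟨B0, BM, B1, Bmean⟩ := lconv_laws c0 c1 cmean e0 e1 emean
  obtain ⟨C0, CM, C1, Cmean⟩ := lconv_laws c0 c1 cmean f0 f1 fmean
  have eB : (1 + 2 * γ) + 3 * (q * (1 + 2 * g) / 3) = (1 + 2 * γ) + q * (1 + 2 * g) := by ring
  have eC : (1 + 2 * γ) + (1 + 2 * ((q * (1 + 2 * g) - 1) / 2)) = (1 + 2 * γ) + q * (1 + 2 * g) := by ring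
  rw [eB] at Bmean; rw [eC] at Cmean
  exact sdec_mix_laws α0 α1 (fun h => lconv_mix_right 3 3 CP[γ] _ _ _ _ (gate_gluedChild_eq_mix hq1 hg0.le hg1) h)
    B0 BM B1 Bmean C0 CM C1 Cmean hB hC

/-- **TWO GLUED CHILDREN: the forest law `gate {1,3;g_b} q_b ∗ gate {1,3;g_a} q_a` is SDEC at every floor `0 < x ≤ min qᵢgᵢ`** (`mᵢ ≥ 2`) —
with the law facts.  Oracle-free. [this work] -/
theorem sdec_gluedChildren2 {x q₁ g₁ q₂ g₂ : ℝ} (hx0 : 0 < x) (hq₁ : 0 < q₁) (hq₁' : q₁ < 1) (hg₁ : 0 < g₁) (hg₁' : g₁ < 1)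
    (hq₂ : 0 < q₂) (hq₂' : q₂ < 1) (hg₂ : 0 < g₂) (hg₂' : g₂ < 1) (hm₁ : 2 ≤ q₁ * (1 + 2 * g₁)) (hm₂ : 2 ≤ q₂ * (1 + 2 * g₂))
    (hx₁ : x ≤ q₁ * g₁) (hx₂ : x ≤ q₂ * g₂) :
    (∀ h, 0 ≤ lconv 3 3 (gate CP[g₂] q₂) (gate CP[g₁] q₁) h) ∧ (∀ h, 3 + 3 < h → lconv 3 3 (gate CP[g₂] q₂) (gate CP[g₁] q₁) h = 0) ∧
      ∑ h ∈ Finset.range (3 + 3 + 1), lconv 3 3 (gate CP[g₂] q₂) (gate CP[g₁] q₁) h = 1 ∧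
      ∑ h ∈ Finset.range (3 + 3 + 1), (h : ℝ) * lconv 3 3 (gate CP[g₂] q₂) (gate CP[g₁] q₁) h = q₂ * (1 + 2 * g₂) + q₁ * (1 + 2 * g₁) ∧
      SDEC x (3 + 3) (lconv 3 3 (gate CP[g₂] q₂) (gate CP[g₁] q₁)) := by
  obtain ⟨h3, α0, α1, s0, s1, γ0, γ1'⟩ := gluedChild_params hq₁ hq₁' hg₁ hg₁' hm₁
  obtain ⟨_, _, hxm₁, hx1⟩ := gluedChild_piece_facts hq₁ hq₁' hg₁ hg₁' hm₁ hx₁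
  have hxs : x ≤ q₁ * (1 + 2 * g₁) / 3 := by linarith
  obtain ⟨t0, tM, t1, tmean⟩ := gluedChild_laws hq₂.le hq₂'.le hg₂.le hg₂'.le
  have hT : SDEC x 3 (gate CP[g₂] q₂) := sdec_gluedChild hq₂ hq₂' hg₂ hg₂' hx₂
  have hta : x * ((3 : ℕ) : ℝ) ≤ q₂ * (1 + 2 * g₂) := by
    push_cast
    have := (gluedChild_piece_facts hq₂ hq₂' hg₂ hg₂' hm₂ hx₂).2.2.1
    linarith
  -- component 1: the blob slice
  obtain ⟨B0, BM, B1, Bmean, hB⟩ := sdec_blob3_step hx0 hx1 hxs s1.le t0 tM t1 tmean hta hT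
  -- component 2: the far-giant piece beside the glued child
  obtain ⟨C0, CM, C1, Cmean, hC⟩ := sdec_farPiece_gluedChild hx0 γ0 γ1' hxm₁ hq₂ hq₂' hg₂ hg₂' hm₂ hx₂
  have eC : lconv 3 3 (gate CP[g₂] q₂) CP[(q₁ * (1 + 2 * g₁) - 1) / 2] = lconv 3 3 CP[(q₁ * (1 + 2 * g₁) - 1) / 2] (gate CP[g₂] q₂) :=
    lconv_comm 3 3 _ _
  have eBm : q₂ * (1 + 2 * g₂) + 3 * (q₁ * (1 + 2 * g₁) / 3) = q₂ * (1 + 2 * g₂) + q₁ * (1 + 2 * g₁) := by ring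
  have eCm : (1 + 2 * ((q₁ * (1 + 2 * g₁) - 1) / 2)) + q₂ * (1 + 2 * g₂) = q₂ * (1 + 2 * g₂) + q₁ * (1 + 2 * g₁) := by ring
  rw [eBm] at Bmean; rw [eCm] at Cmean
  refine sdec_mix_laws α0 α1 (fun h => lconv_mix_right 3 3 (gate CP[g₂] q₂) _ _ _ _ (gate_gluedChild_eq_mix hq₁' hg₁.le hg₁') h)
    B0 BM B1 Bmean ?_ ?_ ?_ ?_ hB ?_
  · intro h; rw [eC]; exact C0 h
  · intro h hh; rw [eC]; exact CM h hh
  · rw [eC]; exact C1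
  · rw [eC]; exact Cmean
  · rw [eC]; exact hC

/-! ### Three glued children -/

/-- **a far-giant piece beside TWO gated glued children is SDEC**: `{1,3;γ} ∗ (gate{1,3;g_b}q_b ∗ gate{1,3;g_a}q_a)` at every floor
`0 < x ≤ min(q_a g_a, q_b g_b)` with `3x ≤ 1+2γ`, `1/2 ≤ γ < 1`, `mᵢ ≥ 2` — expanding `t_a` then `t_b`: blob slices of
`sdec_farPiece_gluedChild` / of the pair hub, and the triple hub. [this work] -/
theorem sdec_farPiece_gluedChildren2 {x γ q₁ g₁ q₂ g₂ : ℝ} (hx0 : 0 < x) (hγ : 1 / 2 ≤ γ) (hγ1 : γ < 1) (hxγ : 3 * x ≤ 1 + 2 * γ)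
    (hq₁ : 0 < q₁) (hq₁' : q₁ < 1) (hg₁ : 0 < g₁) (hg₁' : g₁ < 1) (hq₂ : 0 < q₂) (hq₂' : q₂ < 1) (hg₂ : 0 < g₂) (hg₂' : g₂ < 1)
    (hm₁ : 2 ≤ q₁ * (1 + 2 * g₁)) (hm₂ : 2 ≤ q₂ * (1 + 2 * g₂)) (hx₁ : x ≤ q₁ * g₁) (hx₂ : x ≤ q₂ * g₂) :
    (∀ h, 0 ≤ lconv 3 (3 + 3) CP[γ] (lconv 3 3 (gate CP[g₂] q₂) (gate CP[g₁] q₁)) h) ∧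
    (∀ h, 3 + (3 + 3) < h → lconv 3 (3 + 3) CP[γ] (lconv 3 3 (gate CP[g₂] q₂) (gate CP[g₁] q₁)) h = 0) ∧
      ∑ h ∈ Finset.range (3 + (3 + 3) + 1), lconv 3 (3 + 3) CP[γ] (lconv 3 3 (gate CP[g₂] q₂) (gate CP[g₁] q₁)) h = 1 ∧
      ∑ h ∈ Finset.range (3 + (3 + 3) + 1), (h : ℝ) * lconv 3 (3 + 3) CP[γ] (lconv 3 3 (gate CP[g₂] q₂) (gate CP[g₁] q₁)) h =
        (1 + 2 * γ) + (q₂ * (1 + 2 * g₂) + q₁ * (1 + 2 * g₁)) ∧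
      SDEC x (3 + (3 + 3)) (lconv 3 (3 + 3) CP[γ] (lconv 3 3 (gate CP[g₂] q₂) (gate CP[g₁] q₁))) := by
  obtain ⟨_, α0, α1, s0, s1, γ0, γ1'⟩ := gluedChild_params hq₁ hq₁' hg₁ hg₁' hm₁
  obtain ⟨_, _, hxm₁, hx1⟩ := gluedChild_piece_facts hq₁ hq₁' hg₁ hg₁' hm₁ hx₁
  obtain ⟨_, β0, β1, r0, r1, δ0, δ1'⟩ := gluedChild_params hq₂ hq₂' hg₂ hg₂' hm₂
  obtain ⟨_, _, hxm₂, _⟩ := gluedChild_piece_facts hq₂ hq₂' hg₂ hg₂' hm₂ hx₂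
  have hxs₁ : x ≤ q₁ * (1 + 2 * g₁) / 3 := by linarith
  have hxs₂ : x ≤ q₂ * (1 + 2 * g₂) / 3 := by linarith
  obtain ⟨c0, cM, c1, cmean⟩ := cp_laws (show (0 : ℝ) ≤ γ by linarith) hγ1.le
  -- the core `C(γ) ∗ t₂` (far-giant piece beside the second glued child)
  obtain ⟨K0, KM, K1, Kmean, hK⟩ := sdec_farPiece_gluedChild hx0 hγ hγ1 hxγ hq₂ hq₂' hg₂ hg₂' hm₂ hx₂
  -- component (i): the core sliced by the first child's blob
  obtain ⟨P0, PM, P1, Pmean, hP⟩ := sdec_blob3_step hx0 hx1 hxs₁ s1.le K0 KM K1 Kmean (by push_cast; linarith) hK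
  -- component (ii): `C(γ) ∗ t₂ ∗ C(γ₁)` = the pair hub `C(γ₁) ∗ C(γ)` beside `t₂`, expanded over `t₂`
  obtain ⟨f0, fM, f1, fmean⟩ := cp_laws (show (0 : ℝ) ≤ (q₁ * (1 + 2 * g₁) - 1) / 2 by linarith) γ1'.le
  have hH : SDEC x (3 + 3) (lconv 3 3 CP[(q₁ * (1 + 2 * g₁) - 1) / 2] CP[γ]) := by
    rw [pairHub_eq_lconv]; exact sdec_pairHub hx0 hx1 γ0 γ1' hγ hγ1 hxm₁ hxγ
  obtain ⟨H0, HM, H1, Hmean⟩ := lconv_laws f0 f1 fmean c0 c1 cmean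
  --   (ii-a) pair hub sliced by the second child's blob
  obtain ⟨Q0, QM, Q1, Qmean, hQ⟩ := sdec_blob3_step hx0 hx1 hxs₂ r1.le H0 HM H1 Hmean (by push_cast; linarith) hH
  --   (ii-b) the triple hub
  obtain ⟨u0, uM, u1, umean⟩ := cp_laws (show (0 : ℝ) ≤ (q₂ * (1 + 2 * g₂) - 1) / 2 by linarith) δ1'.le
  have hR : SDEC x (3 + 3 + 3) (lconv (3 + 3) 3 (lconv 3 3 CP[(q₁ * (1 + 2 * g₁) - 1) / 2] CP[γ]) CP[(q₂ * (1 + 2 * g₂) - 1) / 2]) := by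
    rw [pairHub_eq_lconv, tripleHub_eq_lconv]; exact sdec_tripleHub hx0 hx1 γ0 γ1' hγ hγ1 δ0 δ1' hxm₁ hxγ hxm₂
  obtain ⟨R0, RM, R1, Rmean⟩ := lconv_laws H0 H1 Hmean u0 u1 umean
  --   (ii) assembled: `(C(γ₁) ∗ C(γ)) ∗ t₂`
  have eRm : (1 + 2 * ((q₁ * (1 + 2 * g₁) - 1) / 2)) + (1 + 2 * γ) + (1 + 2 * ((q₂ * (1 + 2 * g₂) - 1) / 2)) =
      (1 + 2 * ((q₁ * (1 + 2 * g₁) - 1) / 2)) + (1 + 2 * γ) + 3 * (q₂ * (1 + 2 * g₂) / 3) := by ring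
  rw [eRm] at Rmean
  obtain ⟨S0, SM, S1, Smean, hS⟩ := sdec_mix_laws β0 β1
    (fun h => lconv_mix_right (3 + 3) 3 (lconv 3 3 CP[(q₁ * (1 + 2 * g₁) - 1) / 2] CP[γ]) _ _ _ _ (gate_gluedChild_eq_mix hq₂' hg₂.le hg₂') h)
    Q0 QM Q1 Qmean R0 RM R1 Rmean hQ hR
  -- rewrite (ii) to the shape `C(γ) ∗ (t₂ ∗ C(γ₁))`
  have eS : lconv (3 + 3) 3 (lconv 3 3 CP[(q₁ * (1 + 2 * g₁) - 1) / 2] CP[γ]) (gate CP[g₂] q₂) =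
      lconv 3 (3 + 3) CP[γ] (lconv 3 3 (gate CP[g₂] q₂) CP[(q₁ * (1 + 2 * g₁) - 1) / 2]) := by
    rw [lconv_comm 3 3 CP[(q₁ * (1 + 2 * g₁) - 1) / 2] CP[γ], ← lconv_assoc, lconv_comm 3 3 CP[(q₁ * (1 + 2 * g₁) - 1) / 2]]
  rw [eS] at S0 SM S1 Smean hS
  -- rewrite (i) to the shape `C(γ) ∗ (t₂ ∗ blob₃)`
  have eP : lconv (3 + 3) 3 (lconv 3 3 CP[γ] (gate CP[g₂] q₂)) (gate δ[3] (q₁ * (1 + 2 * g₁) / 3)) =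
      lconv 3 (3 + 3) CP[γ] (lconv 3 3 (gate CP[g₂] q₂) (gate δ[3] (q₁ * (1 + 2 * g₁) / 3))) := by
    rw [← lconv_assoc]
  rw [eP] at P0 PM P1 Pmean hP
  have ePm : (1 + 2 * γ) + q₂ * (1 + 2 * g₂) + 3 * (q₁ * (1 + 2 * g₁) / 3) = (1 + 2 * γ) + (q₂ * (1 + 2 * g₂) + q₁ * (1 + 2 * g₁)) := by ring
  have eSm : (1 + 2 * ((q₁ * (1 + 2 * g₁) - 1) / 2)) + (1 + 2 * γ) + 3 * (q₂ * (1 + 2 * g₂) / 3) =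
      (1 + 2 * γ) + (q₂ * (1 + 2 * g₂) + q₁ * (1 + 2 * g₁)) := by ring
  rw [ePm] at Pmean; rw [eSm] at Smean
  -- the outer mixture over the first child
  have hmix : ∀ h, lconv 3 3 (gate CP[g₂] q₂) (gate CP[g₁] q₁) h =
      3 * (1 - q₁) / (3 - q₁ * (1 + 2 * g₁)) * lconv 3 3 (gate CP[g₂] q₂) (gate δ[3] (q₁ * (1 + 2 * g₁) / 3)) h +
      (1 - 3 * (1 - q₁) / (3 - q₁ * (1 + 2 * g₁))) * lconv 3 3 (gate CP[g₂] q₂) CP[(q₁ * (1 + 2 * g₁) - 1) / 2] h :=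
    fun h => lconv_mix_right 3 3 (gate CP[g₂] q₂) _ _ _ _ (gate_gluedChild_eq_mix hq₁' hg₁.le hg₁') h
  exact sdec_mix_laws α0 α1 (fun h => lconv_mix_right 3 (3 + 3) CP[γ] _ _ _ _ hmix h) P0 PM P1 Pmean S0 SM S1 Smean hP hS

/-- **THREE GLUED CHILDREN — the new minimal open instance of the sibling step is SDEC, oracle-free.**  For `i = 1,2,3`: `0 < qᵢ < 1`,
`0 < gᵢ < 1`, `mᵢ = qᵢ(1+2gᵢ) ≥ 2`, and every floor `0 < x ≤ min qᵢgᵢ` (⊇ all tree-OK floors): the forest law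
`gate{1,3;g₃}q₃ ∗ gate{1,3;g₂}q₂ ∗ gate{1,3;g₁}q₁` of three glued children `R[qᵢ](R²[gᵢ])` is `SDEC x 9` (with its law facts; mean `Σ mᵢ`).
The 8-term piece expansion: each gated child = `αᵢ blob₃(mᵢ/3) + (1−αᵢ) C(γᵢ)`; cores `sdec_farPieceBlob` (one far-giant piece beside a
blob), `sdec_pairHub`, `sdec_tripleHub`; blobs by `sdec_slice'`; mixtures by `sdec_of_mixture`. [this work] -/
theorem sdec_gluedChildren3 {x q₁ g₁ q₂ g₂ q₃ g₃ : ℝ} (hx0 : 0 < x) (hq₁ : 0 < q₁) (hq₁' : q₁ < 1) (hg₁ : 0 < g₁) (hg₁' : g₁ < 1)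
    (hq₂ : 0 < q₂) (hq₂' : q₂ < 1) (hg₂ : 0 < g₂) (hg₂' : g₂ < 1) (hq₃ : 0 < q₃) (hq₃' : q₃ < 1) (hg₃ : 0 < g₃) (hg₃' : g₃ < 1)
    (hm₁ : 2 ≤ q₁ * (1 + 2 * g₁)) (hm₂ : 2 ≤ q₂ * (1 + 2 * g₂)) (hm₃ : 2 ≤ q₃ * (1 + 2 * g₃))
    (hx₁ : x ≤ q₁ * g₁) (hx₂ : x ≤ q₂ * g₂) (hx₃ : x ≤ q₃ * g₃) :
    (∀ h, 0 ≤ lconv (3 + 3) 3 (lconv 3 3 (gate CP[g₃] q₃) (gate CP[g₂] q₂)) (gate CP[g₁] q₁) h) ∧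
    (∀ h, 3 + 3 + 3 < h → lconv (3 + 3) 3 (lconv 3 3 (gate CP[g₃] q₃) (gate CP[g₂] q₂)) (gate CP[g₁] q₁) h = 0) ∧
      ∑ h ∈ Finset.range (3 + 3 + 3 + 1), lconv (3 + 3) 3 (lconv 3 3 (gate CP[g₃] q₃) (gate CP[g₂] q₂)) (gate CP[g₁] q₁) h = 1 ∧
      ∑ h ∈ Finset.range (3 + 3 + 3 + 1), (h : ℝ) * lconv (3 + 3) 3 (lconv 3 3 (gate CP[g₃] q₃) (gate CP[g₂] q₂)) (gate CP[g₁] q₁) h =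
        q₃ * (1 + 2 * g₃) + q₂ * (1 + 2 * g₂) + q₁ * (1 + 2 * g₁) ∧
      SDEC x (3 + 3 + 3) (lconv (3 + 3) 3 (lconv 3 3 (gate CP[g₃] q₃) (gate CP[g₂] q₂)) (gate CP[g₁] q₁)) := by
  obtain ⟨_, α0, α1, s0, s1, γ0, γ1'⟩ := gluedChild_params hq₁ hq₁' hg₁ hg₁' hm₁
  obtain ⟨_, _, hxm₁, hx1⟩ := gluedChild_piece_facts hq₁ hq₁' hg₁ hg₁' hm₁ hx₁
  have hxs₁ : x ≤ q₁ * (1 + 2 * g₁) / 3 := by linarith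
  obtain ⟨_, _, hxm₂, _⟩ := gluedChild_piece_facts hq₂ hq₂' hg₂ hg₂' hm₂ hx₂
  obtain ⟨_, _, hxm₃, _⟩ := gluedChild_piece_facts hq₃ hq₃' hg₃ hg₃' hm₃ hx₃
  -- the width-2 forest `t₃ ∗ t₂`
  obtain ⟨F0, FM, F1, Fmean, hF⟩ := sdec_gluedChildren2 hx0 hq₂ hq₂' hg₂ hg₂' hq₃ hq₃' hg₃ hg₃' hm₂ hm₃ hx₂ hx₃
  -- component 1: sliced by the first child's blob
  obtain ⟨P0, PM, P1, Pmean, hP⟩ := sdec_blob3_step hx0 hx1 hxs₁ s1.le F0 FM F1 Fmean (by push_cast; linarith) hF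
  -- component 2: the first child's far-giant piece beside the width-2 forest
  obtain ⟨S0, SM, S1, Smean, hS⟩ := sdec_farPiece_gluedChildren2 hx0 γ0 γ1' hxm₁ hq₂ hq₂' hg₂ hg₂' hq₃ hq₃' hg₃ hg₃' hm₂ hm₃ hx₂ hx₃
  have eS : lconv 3 (3 + 3) CP[(q₁ * (1 + 2 * g₁) - 1) / 2] (lconv 3 3 (gate CP[g₃] q₃) (gate CP[g₂] q₂)) =
      lconv (3 + 3) 3 (lconv 3 3 (gate CP[g₃] q₃) (gate CP[g₂] q₂)) CP[(q₁ * (1 + 2 * g₁) - 1) / 2] := lconv_comm _ _ _ _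
  rw [eS] at S0 SM S1 Smean hS
  have ePm : q₃ * (1 + 2 * g₃) + q₂ * (1 + 2 * g₂) + 3 * (q₁ * (1 + 2 * g₁) / 3) = q₃ * (1 + 2 * g₃) + q₂ * (1 + 2 * g₂) + q₁ * (1 + 2 * g₁) := by
    ring
  have eSm : (1 + 2 * ((q₁ * (1 + 2 * g₁) - 1) / 2)) + (q₃ * (1 + 2 * g₃) + q₂ * (1 + 2 * g₂)) =
      q₃ * (1 + 2 * g₃) + q₂ * (1 + 2 * g₂) + q₁ * (1 + 2 * g₁) := by ring
  rw [ePm] at Pmean; rw [eSm] at Smean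
  have e9 : (3 + (3 + 3) : ℕ) = 3 + 3 + 3 := by norm_num
  rw [e9] at SM S1 Smean hS
  exact sdec_mix_laws α0 α1 (fun h => lconv_mix_right (3 + 3) 3 _ _ _ _ _ (gate_gluedChild_eq_mix hq₁' hg₁.le hg₁') h)
    P0 PM P1 Pmean S0 SM S1 Smean hP hS

/-- **FOREST-LAW FORM.**  For the three `Sib` records `⟨qᵢ, aᵢ, nᵢ, 3, {1,3;gᵢ}⟩` (any floor/gate-count fields `aᵢ`, `nᵢ`) of three glued
children with `qᵢ(1+2gᵢ) ≥ 2` and every floor `0 < x ≤ min qᵢgᵢ`: `SDEC x (ftop L) (flaw L)`. [this work] -/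
theorem sdec_gluedChildren3_flaw {x q₁ g₁ q₂ g₂ q₃ g₃ : ℝ} (a₁ a₂ a₃ : ℝ) (n₁ n₂ n₃ : ℕ) (hx0 : 0 < x)
    (hq₁ : 0 < q₁) (hq₁' : q₁ < 1) (hg₁ : 0 < g₁) (hg₁' : g₁ < 1) (hq₂ : 0 < q₂) (hq₂' : q₂ < 1) (hg₂ : 0 < g₂) (hg₂' : g₂ < 1)
    (hq₃ : 0 < q₃) (hq₃' : q₃ < 1) (hg₃ : 0 < g₃) (hg₃' : g₃ < 1)
    (hm₁ : 2 ≤ q₁ * (1 + 2 * g₁)) (hm₂ : 2 ≤ q₂ * (1 + 2 * g₂)) (hm₃ : 2 ≤ q₃ * (1 + 2 * g₃))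
    (hx₁ : x ≤ q₁ * g₁) (hx₂ : x ≤ q₂ * g₂) (hx₃ : x ≤ q₃ * g₃) :
    SDEC x (ftop [(⟨q₁, a₁, n₁, 3, CP[g₁]⟩ : Sib), ⟨q₂, a₂, n₂, 3, CP[g₂]⟩, ⟨q₃, a₃, n₃, 3, CP[g₃]⟩])
      (flaw [(⟨q₁, a₁, n₁, 3, CP[g₁]⟩ : Sib), ⟨q₂, a₂, n₂, 3, CP[g₂]⟩, ⟨q₃, a₃, n₃, 3, CP[g₃]⟩]) := by
  obtain ⟨_, tM, _, _⟩ := gluedChild_laws hq₃.le hq₃'.le hg₃.le hg₃'.le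
  have e3 : lconv 0 3 δ[0] (gate CP[g₃] q₃) = gate CP[g₃] q₃ := funext fun h => lconv_delta_left 0 3 _ tM h
  have h := (sdec_gluedChildren3 hx0 hq₁ hq₁' hg₁ hg₁' hq₂ hq₂' hg₂ hg₂' hq₃ hq₃' hg₃ hg₃' hm₁ hm₂ hm₃ hx₁ hx₂ hx₃).2.2.2.2
  show SDEC x (0 + 3 + 3 + 3) (lconv (0 + 3 + 3) 3 (lconv (0 + 3) 3 (lconv 0 3 δ[0] (gate CP[g₃] q₃)) (gate CP[g₂] q₂)) (gate CP[g₁] q₁))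
  rw [e3]
  exact h

end LawDec
end Quant
end Summit.CriticalPhenomena.PercolationContinuityZ3.Theorems
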